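import Mathlib.Analysis.Complex.Liouville
import Mathlib.Analysis.Calculus.MeanValue
import Mathlib.Analysis.Normed.Module.RCLike.Real
import HarnessLib

/-!
# Crux `FluctuationComparisonRegPrIntL` (stmt-QuantumFields-20520, rung R3), PATH-B organ — «THE TWO-STEP CAUCHY ESTIMATE FOR A DOUBLE
# DIFFERENCE ON A BIDISC» (UV3-NODE §80.4 (b) ∕ §80.7; amendment A5 of the (I-curv) group; DEFINITION-FREE): print's (3.15)∕(3.17)∕(3.54)
# template ([Balaban1987RG1] pp.273, 280 — lit `B12CauchyRemainder354`) in TWO parameters, by two ONE-variable Cauchy steps (no mixed partial,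
# no Hartogs)

Cell `ym3-torus` (YM ladder rung R3 = continuum `SU(2)` Yang–Mills on the three-torus — a RUNG: NOT d = 4, NOT infinite volume, NOT a mass gap, NOT
Clay).  Width seat `ym3-torus-px19` (gen 22, the §72∕§73∕§74∕§80 lineage); `--kind proof --supports stmt-QuantumFields-20520 --as helper`, count-neutral,
no registry ∕ binder ∕ `Lines/` edit, default heartbeats, `autoImplicit false`; imports Mathlib + HarnessLib only.

WHAT.  For a function `f : ℂ → F` holomorphic on `ball 0 R` with `1 + r < R` and τ-OSCILLATION `‖f τ − f τ′‖ ≤ M` on that ball,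
★`norm_sub_le_of_osc`: `‖f 1 − f 0‖ ≤ M ∕ r` (Cauchy's estimate for `f′` on circles of radius `r` about the points of the closed unit disc, centre value
subtracted — Mathlib `Complex.norm_deriv_le_of_forall_mem_sphere_norm_le` — then the mean value inequality on the convex closed unit disc —
Mathlib `Convex.norm_image_sub_le_of_norm_deriv_le`).  For `H : ℂ → ℂ → F` SEPARATELY holomorphic — `σ ↦ H σ 0`, `σ ↦ H σ 1` on `ball 0 R`
(`1 + r < R`) and `τ ↦ H σ τ` on `ball 0 R′` (`1 + r′ < R′`) for every `σ ∈ ball 0 R` — with τ-oscillation `‖H σ τ − H σ τ′‖ ≤ M` uniformly in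
`σ ∈ ball 0 R`, ★★`norm_doubleDiff_le_of_sep_holo`: `‖H 1 1 − H 1 0 − H 0 1 + H 0 0‖ ≤ 2·M ∕ (r·r′)` (★ applied to each `H σ`, then ★ applied to
`σ ↦ H σ 1 − H σ 0`, whose oscillation is `≤ 2·M∕r′`); ★★`norm_doubleDiff_le_of_sep_holo'` the version with the rôles of `σ, τ` exchanged
(σ-oscillation uniformly on the τ-disc), and `norm_doubleDiff_le_min` the `min` of the two.

WHY (UV3-NODE §80, LOCATE (b) «TN-GRAD-W», LEAD w3 g27 №11 ∕ ★★OWNER №434 (4)): Bałaban never forms a second derivative in the coarse variable at a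
general background — sizes come from Cauchy integrals on the analyticity domain ((3.15), (3.54); Sect. G (185)), decay from the first-order response
(190).  On that road the (I-curv) group's double-difference `ΔΔ_{sq}(h_Y∘Φ)(z)` over an admissible coarse square is bounded by THIS lemma with
`H σ τ := h_Y(Φ(sq(σ,τ), z)|_Y)` complexified, `r ≈ ϱ∕‖v‖`, `r′ ≈ ϱ∕‖v′‖` (`ϱ` = coarse-link analyticity radius) and `M` = (tube-Lipschitz letter of
the localised piece `h_Y`) × (the chart's first-order complex-domain response with decay): the product `sz·sz′` comes from `1∕(r·r′)`, no Hessian of `h`,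
no second derivative of the chart, no plaquette index — amendment A5's one pair letter `kG`.  This file is the abstract Cauchy kernel only; the
holomorphy and oscillation inputs (§74 G1-a tube analyticity of both runs' densities; §73 G0-b∕G0-c chart analyticity and (190)-decay) are NOT
constructed here.

HONEST FRAMING: one-variable complex analysis over ABSTRACT holomorphic functions; nothing of Bałaban's analysis is asserted or proved; the (I-curv) row
(every edition), `SpreadFibreLawH(J)(sq)`, `OrganDischargeInputsHJ(sq)`, O1ᵘ-H v2.2, S1aᴴ, S3ᴴ, S2α′, S2β, 26243, the five registered stubs, crux 20520
`FluctuationComparisonRegPrIntL` and `YM3TorusSU2` are NOT proved; no summit ∕ sub-problem statement is proved; registry `Lines/semiclassical_s2beta.lean`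
3732b7df untouched; rung R3 = SU(2) YM₃ on T³ at fixed lattice data — NOT d = 4, NOT infinite volume, NOT a mass gap, NOT Clay; the Yang–Mills mass gap
is NOT proved.  [folklore; cite: Balaban1987RG1, (3.15)–(3.17) p.273, (3.54) p.280 — the one-parameter template]
-/

set_option autoImplicit false

noncomputable section

namespace Summit.QuantumFields.YangMills.Theorems.OrganTangentBidiscDoubleDifference

open Metric Set Complex

variable {F : Type*} [NormedAddCommGroup F] [NormedSpace ℂ F]

/-! ## §1 One variable: oscillation on a disc of radius `> 1 + r` bounds the unit step by `M ∕ r` -/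

/-- A closed disc of radius `r` about a point of the closed unit disc lies in the open disc of radius `R > 1 + r`. [folklore] -/
theorem closedBall_subset_ball_of_mem_unit {x : ℂ} {r R : ℝ} (hx : x ∈ closedBall (0 : ℂ) 1) (hrR : 1 + r < R) :
    closedBall x r ⊆ ball (0 : ℂ) R := by
  intro z hz
  rw [mem_closedBall, dist_eq_norm] at hz
  rw [mem_closedBall, dist_zero_right] at hx
  rw [mem_ball, dist_zero_right]
  calc ‖z‖ = ‖(z - x) + x‖ := by rw [sub_add_cancel]
    _ ≤ ‖z - x‖ + ‖x‖ := norm_add_le _ _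
    _ ≤ r + 1 := add_le_add hz hx
    _ < R := by linarith

/-- Cauchy's estimate with the centre value subtracted: `f` holomorphic on `ball 0 R`, `1 + r < R`, `0 < r`, τ-oscillation `≤ M` on the ball
⟹ `‖f′ x‖ ≤ M ∕ r` at every point `x` of the closed unit disc. [folklore; cite: Balaban1987RG1, (3.17) p.273 — one-parameter template] -/
theorem norm_deriv_le_of_osc {f : ℂ → F} {r R M : ℝ} (hr : 0 < r) (hrR : 1 + r < R)
    (hf : DifferentiableOn ℂ f (ball 0 R))
    (hM : ∀ τ ∈ ball (0 : ℂ) R, ∀ τ' ∈ ball (0 : ℂ) R, ‖f τ - f τ'‖ ≤ M)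
    {x : ℂ} (hx : x ∈ closedBall (0 : ℂ) 1) : ‖deriv f x‖ ≤ M / r := by
  have hxR : closedBall x r ⊆ ball (0 : ℂ) R := closedBall_subset_ball_of_mem_unit hx hrR
  have hxin : x ∈ ball (0 : ℂ) R := hxR (mem_closedBall_self hr.le)
  -- the function with the centre value subtracted
  have hdc : DiffContOnCl ℂ (fun z => f z - f x) (ball x r) := by
    refine ⟨(hf.mono (ball_subset_closedBall.trans hxR)).sub_const _, ?_⟩
    rw [closure_ball x hr.ne']
    exact ((hf.mono hxR).sub_const _).continuousOn
  have hsph : ∀ z ∈ sphere x r, ‖f z - f x‖ ≤ M := fun z hz =>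
    hM z (hxR (sphere_subset_closedBall hz)) x hxin
  have h := Complex.norm_deriv_le_of_forall_mem_sphere_norm_le hr hdc hsph
  rwa [deriv_sub_const] at h

/-- ★ ONE-VARIABLE STEP: `f` holomorphic on `ball 0 R`, `0 < r`, `1 + r < R`, oscillation `‖f τ − f τ′‖ ≤ M` on the ball ⟹ `‖f 1 − f 0‖ ≤ M ∕ r`
(derivative bound `M∕r` on the closed unit disc + the mean value inequality on that convex set). [folklore; cite: Balaban1987RG1, (3.15)–(3.17) p.273] -/
theorem norm_sub_le_of_osc {f : ℂ → F} {r R M : ℝ} (hr : 0 < r) (hrR : 1 + r < R)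
    (hf : DifferentiableOn ℂ f (ball 0 R))
    (hM : ∀ τ ∈ ball (0 : ℂ) R, ∀ τ' ∈ ball (0 : ℂ) R, ‖f τ - f τ'‖ ≤ M) :
    ‖f 1 - f 0‖ ≤ M / r := by
  have hdiff : ∀ x ∈ closedBall (0 : ℂ) 1, DifferentiableAt ℂ f x := by
    intro x hx
    refine hf.differentiableAt (isOpen_ball.mem_nhds ?_)
    exact closedBall_subset_ball_of_mem_unit hx hrR (mem_closedBall_self (by linarith))
  have hbound : ∀ x ∈ closedBall (0 : ℂ) 1, ‖deriv f x‖ ≤ M / r :=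
    fun x hx => norm_deriv_le_of_osc hr hrR hf hM hx
  have h1 : (1 : ℂ) ∈ closedBall (0 : ℂ) 1 := by simp
  have h0 : (0 : ℂ) ∈ closedBall (0 : ℂ) 1 := by simp
  have h := (convex_closedBall (0 : ℂ) 1).norm_image_sub_le_of_norm_deriv_le hdiff hbound h0 h1
  simpa using h

/-! ## §2 Two variables, separately holomorphic: the double difference -/

/-- ★★ **THE TWO-STEP CAUCHY ESTIMATE FOR A DOUBLE DIFFERENCE** (τ-oscillation version).  `H : ℂ → ℂ → F` with `σ ↦ H σ 0` and `σ ↦ H σ 1`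
holomorphic on `ball 0 R` (`1 + r < R`), `τ ↦ H σ τ` holomorphic on `ball 0 R′` (`1 + r′ < R′`) for every `σ ∈ ball 0 R`, and τ-oscillation
`‖H σ τ − H σ τ′‖ ≤ M` for `σ ∈ ball 0 R`, `τ, τ′ ∈ ball 0 R′` ⟹ `‖H 1 1 − H 1 0 − H 0 1 + H 0 0‖ ≤ 2·M ∕ (r·r′)`.
No mixed partial derivative is formed: ★ bounds `D σ := H σ 1 − H σ 0` by `M∕r′` for every `σ` in the disc, then ★ bounds `D 1 − D 0` from `D`'s
oscillation `≤ 2M∕r′`. [folklore; cite: Balaban1987RG1, (3.15)–(3.17) p.273, (3.54) p.280 — the one-parameter template, applied twice] -/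
theorem norm_doubleDiff_le_of_sep_holo {H : ℂ → ℂ → F} {r r' R R' M : ℝ}
    (hr : 0 < r) (hrR : 1 + r < R) (hr' : 0 < r') (hr'R' : 1 + r' < R')
    (hσ0 : DifferentiableOn ℂ (fun σ => H σ 0) (ball 0 R))
    (hσ1 : DifferentiableOn ℂ (fun σ => H σ 1) (ball 0 R))
    (hτ : ∀ σ ∈ ball (0 : ℂ) R, DifferentiableOn ℂ (H σ) (ball 0 R'))
    (hM : ∀ σ ∈ ball (0 : ℂ) R, ∀ τ ∈ ball (0 : ℂ) R', ∀ τ' ∈ ball (0 : ℂ) R', ‖H σ τ - H σ τ'‖ ≤ M) :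
    ‖H 1 1 - H 1 0 - H 0 1 + H 0 0‖ ≤ 2 * M / (r * r') := by
  -- step 1: the τ-step at every σ of the big disc
  have hD : ∀ σ ∈ ball (0 : ℂ) R, ‖H σ 1 - H σ 0‖ ≤ M / r' :=
    fun σ hσ => norm_sub_le_of_osc hr' hr'R' (hτ σ hσ) (hM σ hσ)
  -- step 2: the σ-step for `D σ := H σ 1 − H σ 0`
  have hDhol : DifferentiableOn ℂ (fun σ => H σ 1 - H σ 0) (ball 0 R) := hσ1.sub hσ0
  have hDosc : ∀ σ ∈ ball (0 : ℂ) R, ∀ σ' ∈ ball (0 : ℂ) R,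
      ‖(H σ 1 - H σ 0) - (H σ' 1 - H σ' 0)‖ ≤ 2 * M / r' := by
    intro σ hσ σ' hσ'
    calc ‖(H σ 1 - H σ 0) - (H σ' 1 - H σ' 0)‖
        ≤ ‖H σ 1 - H σ 0‖ + ‖H σ' 1 - H σ' 0‖ := norm_sub_le _ _
      _ ≤ M / r' + M / r' := add_le_add (hD σ hσ) (hD σ' hσ')
      _ = 2 * M / r' := by ring
  have h := norm_sub_le_of_osc hr hrR hDhol hDosc
  have heq : (H 1 1 - H 1 0) - (H 0 1 - H 0 0) = H 1 1 - H 1 0 - H 0 1 + H 0 0 := by abel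
  rw [heq] at h
  calc ‖H 1 1 - H 1 0 - H 0 1 + H 0 0‖ ≤ 2 * M / r' / r := h
    _ = 2 * M / (r * r') := by rw [div_div, mul_comm r' r]

/-- ★★ The σ-oscillation version (rôles exchanged): `τ ↦ H 0 τ`, `τ ↦ H 1 τ` holomorphic on `ball 0 R′`, `σ ↦ H σ τ` holomorphic on `ball 0 R`
for every `τ ∈ ball 0 R′`, σ-oscillation `‖H σ τ − H σ′ τ‖ ≤ M′` for `τ ∈ ball 0 R′`, `σ, σ′ ∈ ball 0 R` ⟹ the same double difference is
`≤ 2·M′ ∕ (r·r′)`. [folklore] -/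
theorem norm_doubleDiff_le_of_sep_holo' {H : ℂ → ℂ → F} {r r' R R' M' : ℝ}
    (hr : 0 < r) (hrR : 1 + r < R) (hr' : 0 < r') (hr'R' : 1 + r' < R')
    (hτ0 : DifferentiableOn ℂ (H 0) (ball 0 R'))
    (hτ1 : DifferentiableOn ℂ (H 1) (ball 0 R'))
    (hσ : ∀ τ ∈ ball (0 : ℂ) R', DifferentiableOn ℂ (fun σ => H σ τ) (ball 0 R))
    (hM' : ∀ τ ∈ ball (0 : ℂ) R', ∀ σ ∈ ball (0 : ℂ) R, ∀ σ' ∈ ball (0 : ℂ) R, ‖H σ τ - H σ' τ‖ ≤ M') :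
    ‖H 1 1 - H 1 0 - H 0 1 + H 0 0‖ ≤ 2 * M' / (r * r') := by
  -- apply the τ-version to the transposed function
  have h := norm_doubleDiff_le_of_sep_holo (H := fun τ σ => H σ τ) hr' hr'R' hr hrR hτ0 hτ1 hσ hM'
  have heq : H 1 1 - H 0 1 - H 1 0 + H 0 0 = H 1 1 - H 1 0 - H 0 1 + H 0 0 := by abel
  have h' : ‖H 1 1 - H 0 1 - H 1 0 + H 0 0‖ ≤ 2 * M' / (r' * r) := h
  rw [heq, mul_comm r' r] at h'
  exact h'

/-- The `min` of the two versions under JOINT hypotheses (every slice holomorphic; both oscillation letters): the double difference is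
`≤ 2·min M M′ ∕ (r·r′)` — the shape used in UV3-NODE §80.4 (b) (`min` of the two first-order responses gives the `max`-distance decay). [folklore] -/
theorem norm_doubleDiff_le_min {H : ℂ → ℂ → F} {r r' R R' M M' : ℝ}
    (hr : 0 < r) (hrR : 1 + r < R) (hr' : 0 < r') (hr'R' : 1 + r' < R')
    (hσ : ∀ τ ∈ ball (0 : ℂ) R', DifferentiableOn ℂ (fun σ => H σ τ) (ball 0 R))
    (hτ : ∀ σ ∈ ball (0 : ℂ) R, DifferentiableOn ℂ (H σ) (ball 0 R'))
    (hM : ∀ σ ∈ ball (0 : ℂ) R, ∀ τ ∈ ball (0 : ℂ) R', ∀ τ' ∈ ball (0 : ℂ) R', ‖H σ τ - H σ τ'‖ ≤ M)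
    (hM' : ∀ τ ∈ ball (0 : ℂ) R', ∀ σ ∈ ball (0 : ℂ) R, ∀ σ' ∈ ball (0 : ℂ) R, ‖H σ τ - H σ' τ‖ ≤ M') :
    ‖H 1 1 - H 1 0 - H 0 1 + H 0 0‖ ≤ 2 * min M M' / (r * r') := by
  have h0R' : (0 : ℂ) ∈ ball (0 : ℂ) R' := mem_ball_self (by linarith)
  have h1R' : (1 : ℂ) ∈ ball (0 : ℂ) R' := by
    rw [mem_ball, dist_zero_right, norm_one]; linarith
  have h0R : (0 : ℂ) ∈ ball (0 : ℂ) R := mem_ball_self (by linarith)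
  have h1R : (1 : ℂ) ∈ ball (0 : ℂ) R := by
    rw [mem_ball, dist_zero_right, norm_one]; linarith
  have hA := norm_doubleDiff_le_of_sep_holo hr hrR hr' hr'R' (hσ 0 h0R') (hσ 1 h1R') hτ hM
  have hB := norm_doubleDiff_le_of_sep_holo' hr hrR hr' hr'R' (hτ 0 h0R) (hτ 1 h1R) hσ hM'
  rcases le_total M M' with hle | hle
  · rw [min_eq_left hle]; exact hA
  · rw [min_eq_right hle]; exact hB

end Summit.QuantumFields.YangMills.Theorems.OrganTangentBidiscDoubleDifference

end
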